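import Mathlib

/-!
# PercRepro — the binomial layer (N1) of mine-2's Theorem N: the sums `T(n, j)` (typer-2, gen 6)

`proofs/MINE2-RLS.md` §14 (Theorem N, `(RLS)(p, 2)` for every matroid) rests on three inequalities between the
rational numbers `F(p, b) = Σ_{x=1}^{p−3} C(p−1, x)·C(b, 2)/C(b+x, 2)` (`b = 2, 3, 4`) and `Φ(p, 2)`. Everything is a
linear combination of the sums `T(n, j) = Σ_{x=0}^{n} C(n, x)/(x + j)`, so this file first computes those:

* **`sum_choose_mul_div`** — `Σ_x C(n, x)·x/(x + j) = 2ⁿ − j·T(n, j)` (`x/(x+j) = 1 − j/(x+j)`);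
* **`sum_succ_choose_mul_div`** — `Σ_x C(n+1, x)·x/(x + j) = (n + 1)·T(n, j + 1)` (`(n+1)·C(n, y) = C(n+1, y+1)·(y+1)`);
* **`T_succ`** — Pascal: `T(n+1, j) = T(n, j) + T(n, j+1)`;
* **`T_recursion`** — the fixed-`j` recursion `(n + 1 + j)·T(n+1, j) = (n+1)·T(n, j) + 2^{n+1}`;
* **`T_one` … `T_four`** — closed forms with `g(m) = (2^{m+1} − 1)/(m + 1)`:
  `T(n,1) = g n`, `T(n,2) = g(n+1) − g n`, `T(n,3) = g(n+2) − 2g(n+1) + g n`,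
  `T(n,4) = g(n+3) − 3g(n+2) + 3g(n+1) − g n`.
-/

namespace PercRepro

open Finset

namespace BinomialLayer

/-- `T(n, j) = Σ_{x=0}^{n} C(n, x) / (x + j)`. -/
def T (n j : ℕ) : ℚ := ∑ x ∈ range (n + 1), (n.choose x : ℚ) / (x + j)

/-- `T(0, j) = 1/j`. -/
theorem T_zero (j : ℕ) : T 0 j = 1 / j := by
  simp [T]

/-- `Σ_x C(n, x)·x/(x + j) = 2ⁿ − j·T(n, j)` for `j ≥ 1`. -/
theorem sum_choose_mul_div (n j : ℕ) (hj : 1 ≤ j) :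
    ∑ x ∈ range (n + 1), (n.choose x : ℚ) * x / (x + j) = 2 ^ n - j * T n j := by
  have hsum : (∑ x ∈ range (n + 1), (n.choose x : ℚ)) = 2 ^ n := by
    exact_mod_cast Nat.sum_range_choose n
  rw [T, Finset.mul_sum, ← hsum, ← Finset.sum_sub_distrib]
  refine Finset.sum_congr rfl fun x _ => ?_
  have hne : (x : ℚ) + j ≠ 0 := by
    have : (1 : ℚ) ≤ (j : ℚ) := by exact_mod_cast hj
    positivity
  field_simp
  ring

/-- `Σ_x C(n+1, x)·x/(x + j) = (n + 1)·T(n, j + 1)`. -/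
theorem sum_succ_choose_mul_div (n j : ℕ) :
    ∑ x ∈ range (n + 2), ((n + 1).choose x : ℚ) * x / (x + j) = (n + 1) * T n (j + 1) := by
  rw [Finset.sum_range_succ', T, Finset.mul_sum]
  simp only [Nat.cast_zero, mul_zero, zero_div, add_zero]
  refine Finset.sum_congr rfl fun y _ => ?_
  have h := Nat.add_one_mul_choose_eq n y
  have h' : ((n + 1 : ℕ) : ℚ) * (n.choose y : ℚ) = ((n + 1).choose (y + 1) : ℚ) * ((y + 1 : ℕ) : ℚ) := by
    exact_mod_cast h
  push_cast at h' ⊢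
  rw [← h']
  ring

/-- Pascal: `T(n+1, j) = T(n, j) + T(n, j+1)`. -/
theorem T_succ (n j : ℕ) : T (n + 1) j = T n j + T n (j + 1) := by
  unfold T
  rw [Finset.sum_range_succ' (fun x => ((n + 1).choose x : ℚ) / (x + j)) (n + 1)]
  have hpas : ∀ y ∈ range (n + 1), ((n + 1).choose (y + 1) : ℚ) / (((y + 1 : ℕ) : ℚ) + j) =
      (n.choose y : ℚ) / (y + (j + 1 : ℕ)) + (n.choose (y + 1) : ℚ) / (((y + 1 : ℕ) : ℚ) + j) := by
    intro y _
    rw [Nat.choose_succ_succ]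
    push_cast
    rw [add_div]
    congr 2
    ring
  rw [Finset.sum_congr rfl hpas, Finset.sum_add_distrib]
  -- `Σ_{y<n+1} C(n, y+1)/(y+1+j) + C(n+1,0)/j = Σ_{x<n+1} C(n, x)/(x+j)`
  have hshift : ∑ y ∈ range (n + 1), (n.choose (y + 1) : ℚ) / (((y + 1 : ℕ) : ℚ) + j) +
      ((n + 1).choose 0 : ℚ) / ((0 : ℕ) + j : ℚ) = ∑ x ∈ range (n + 1), (n.choose x : ℚ) / (x + j) := by
    rw [Finset.sum_range_succ' (fun x => (n.choose x : ℚ) / (x + j)) n]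
    have hlast : ∑ y ∈ range (n + 1), (n.choose (y + 1) : ℚ) / (((y + 1 : ℕ) : ℚ) + j) =
        ∑ y ∈ range n, (n.choose (y + 1) : ℚ) / (((y + 1 : ℕ) : ℚ) + j) := by
      rw [Finset.sum_range_succ, Nat.choose_succ_self]
      simp
    rw [hlast]
    simp
  linarith [hshift]

/-- **The fixed-`j` recursion**: `(n + 1 + j)·T(n+1, j) = (n+1)·T(n, j) + 2^{n+1}` for `j ≥ 1`. -/
theorem T_recursion (n j : ℕ) (hj : 1 ≤ j) :
    ((n : ℚ) + 1 + j) * T (n + 1) j = (n + 1) * T n j + 2 ^ (n + 1) := by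
  have hA := sum_choose_mul_div (n + 1) j hj
  have hB := sum_succ_choose_mul_div n j
  have hC := T_succ n j
  -- `(n+1)·T(n, j+1) = 2^{n+1} − j·T(n+1, j)` and `T(n, j+1) = T(n+1, j) − T(n, j)`
  have h1 : ((n : ℚ) + 1) * T n (j + 1) = 2 ^ (n + 1) - j * T (n + 1) j := by
    rw [← hB, hA]
  linear_combination h1 + ((n : ℚ) + 1) * hC

/-- `g(m) = (2^{m+1} − 1)/(m + 1)`. -/
def g (m : ℕ) : ℚ := (2 ^ (m + 1) - 1) / (m + 1)

/-- `T(n, 1) = g n`. -/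
theorem T_one (n : ℕ) : T n 1 = g n := by
  induction n with
  | zero => norm_num [T_zero, g]
  | succ n ih =>
    have h := T_recursion n 1 le_rfl
    rw [ih] at h
    have hne : ((n : ℚ) + 1 + 1) ≠ 0 := by positivity
    have hne' : ((n : ℚ) + 1) ≠ 0 := by positivity
    unfold g at h ⊢
    push_cast
    field_simp at h ⊢
    linear_combination h

/-- `T(n, 2) = g(n+1) − g n`. -/
theorem T_two (n : ℕ) : T n 2 = g (n + 1) - g n := by
  induction n with
  | zero => norm_num [T_zero, g]
  | succ n ih =>
    have h := T_recursion n 2 (by norm_num)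
    rw [ih] at h
    unfold g at h ⊢
    push_cast at h ⊢
    have h1 : ((n : ℚ) + 1) ≠ 0 := by positivity
    have h2 : ((n : ℚ) + 1 + 1) ≠ 0 := by positivity
    have h3 : ((n : ℚ) + 1 + 1 + 1) ≠ 0 := by positivity
    have h4 : ((n : ℚ) + 1 + 2) ≠ 0 := by positivity
    field_simp at h ⊢
    linear_combination h

/-- `T(n, 3) = g(n+2) − 2·g(n+1) + g n`. -/
theorem T_three (n : ℕ) : T n 3 = g (n + 2) - 2 * g (n + 1) + g n := by
  induction n with
  | zero => norm_num [T_zero, g]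
  | succ n ih =>
    have h := T_recursion n 3 (by norm_num)
    rw [ih] at h
    unfold g at h ⊢
    push_cast at h ⊢
    have h1 : ((n : ℚ) + 1) ≠ 0 := by positivity
    have h2 : ((n : ℚ) + 1 + 1) ≠ 0 := by positivity
    have h3 : ((n : ℚ) + 2 + 1) ≠ 0 := by positivity
    have h4 : ((n : ℚ) + 1 + 3) ≠ 0 := by positivity
    have h5 : ((n : ℚ) + 1 + 2 + 1) ≠ 0 := by positivity
    have h6 : ((n : ℚ) + 1 + 1 + 1) ≠ 0 := by positivity
    field_simp at h ⊢
    linear_combination h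

/-- `T(n, 4) = g(n+3) − 3·g(n+2) + 3·g(n+1) − g n`. -/
theorem T_four (n : ℕ) : T n 4 = g (n + 3) - 3 * g (n + 2) + 3 * g (n + 1) - g n := by
  induction n with
  | zero => norm_num [T_zero, g]
  | succ n ih =>
    have h := T_recursion n 4 (by norm_num)
    rw [ih] at h
    unfold g at h ⊢
    push_cast at h ⊢
    have h1 : ((n : ℚ) + 1) ≠ 0 := by positivity
    have h2 : ((n : ℚ) + 1 + 1) ≠ 0 := by positivity
    have h3 : ((n : ℚ) + 2 + 1) ≠ 0 := by positivity
    have h4 : ((n : ℚ) + 3 + 1) ≠ 0 := by positivity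
    have h5 : ((n : ℚ) + 1 + 4) ≠ 0 := by positivity
    have h6 : ((n : ℚ) + 1 + 3 + 1) ≠ 0 := by positivity
    have h7 : ((n : ℚ) + 1 + 2 + 1) ≠ 0 := by positivity
    have h8 : ((n : ℚ) + 1 + 1 + 1) ≠ 0 := by positivity
    field_simp at h ⊢
    linear_combination h

/-! ### The truncated sums, `F(p, b)` and `Φ(p, 2)` -/

/-- `T′(n, j) = Σ_{x=1}^{n−2} C(n, x)/(x + j)` (the range of mine-2's `F`: `x = 1 … p − 3` with `n = p − 1`). -/
def Tp (n j : ℕ) : ℚ := ∑ x ∈ Ico 1 (n - 1), (n.choose x : ℚ) / (x + j)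

/-- `T′(n, j) = T(n, j) − 1/j − n/(n − 1 + j) − 1/(n + j)` for `n ≥ 2` (the terms `x = 0, n − 1, n`). -/
theorem Tp_eq (n j : ℕ) (hn : 2 ≤ n) :
    Tp n j = T n j - 1 / j - n / ((n - 1 : ℕ) + j) - 1 / (n + j) := by
  obtain ⟨m, rfl⟩ : ∃ m, n = m + 2 := ⟨n - 2, by omega⟩
  unfold Tp T
  rw [Finset.sum_Ico_eq_sub _ (by omega : 1 ≤ m + 2 - 1), Finset.sum_range_one]
  have e1 : m + 2 - 1 = m + 1 := by omega
  rw [e1, Finset.sum_range_succ (fun x => ((m + 2).choose x : ℚ) / (x + j)) (m + 2),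
    Finset.sum_range_succ (fun x => ((m + 2).choose x : ℚ) / (x + j)) (m + 1)]
  simp only [Nat.choose_zero_right, Nat.choose_self, Nat.choose_succ_self_right, Nat.cast_zero,
    Nat.cast_one, zero_add]
  push_cast
  ring

/-- mine-2's `F(p, b) = Σ_{x=1}^{p−3} C(p−1, x)·C(b, 2)/C(b+x, 2)`. -/
def F (p b : ℕ) : ℚ := ∑ x ∈ Ico 1 (p - 2), ((p - 1).choose x : ℚ) * (b.choose 2 : ℚ) / ((b + x).choose 2 : ℚ)

/-- `Φ(p, 2) = Σ_{2<u<p} C(p+2, u) / C(p+2, p)` (the spelling of `phiK p 2`). -/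
def phiTwo (p : ℕ) : ℚ := (∑ u ∈ Ioo 2 p, ((p + 2).choose u : ℚ)) / ((p + 2).choose p : ℚ)

/-- `F(p, 2) = 2·(T′(n, 1) − T′(n, 2))`, `n = p − 1`, for `p ≥ 4`. -/
theorem F_two (p : ℕ) (hp : 4 ≤ p) : F p 2 = 2 * (Tp (p - 1) 1 - Tp (p - 1) 2) := by
  unfold F Tp
  have e : p - 1 - 1 = p - 2 := by omega
  rw [e, mul_sub, Finset.mul_sum, Finset.mul_sum, ← Finset.sum_sub_distrib]
  refine Finset.sum_congr rfl fun x hx => ?_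
  rw [Finset.mem_Ico] at hx
  rw [Nat.cast_choose_two, Nat.cast_choose_two]
  push_cast
  have h1 : (x : ℚ) + 1 ≠ 0 := by positivity
  have h2 : (x : ℚ) + 2 ≠ 0 := by positivity
  have h1' : (1 : ℚ) + x ≠ 0 := by positivity
  have h2' : (2 : ℚ) + x ≠ 0 := by positivity
  rw [show ((2 : ℚ) + x - 1) = 1 + x by ring]
  field_simp
  ring

/-- `F(p, 3) = 6·(T′(n, 2) − T′(n, 3))`, `n = p − 1`, for `p ≥ 4`. -/
theorem F_three (p : ℕ) (hp : 4 ≤ p) : F p 3 = 6 * (Tp (p - 1) 2 - Tp (p - 1) 3) := by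
  unfold F Tp
  have e : p - 1 - 1 = p - 2 := by omega
  rw [e, mul_sub, Finset.mul_sum, Finset.mul_sum, ← Finset.sum_sub_distrib]
  refine Finset.sum_congr rfl fun x hx => ?_
  rw [Finset.mem_Ico] at hx
  rw [Nat.cast_choose_two, Nat.cast_choose_two]
  push_cast
  have h1 : (x : ℚ) + 2 ≠ 0 := by positivity
  have h2 : (x : ℚ) + 3 ≠ 0 := by positivity
  have h1' : (2 : ℚ) + x ≠ 0 := by positivity
  have h2' : (3 : ℚ) + x ≠ 0 := by positivity
  rw [show ((3 : ℚ) + x - 1) = 2 + x by ring]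
  field_simp
  ring

/-- `F(p, 4) = 12·(T′(n, 3) − T′(n, 4))`, `n = p − 1`, for `p ≥ 4`. -/
theorem F_four (p : ℕ) (hp : 4 ≤ p) : F p 4 = 12 * (Tp (p - 1) 3 - Tp (p - 1) 4) := by
  unfold F Tp
  have e : p - 1 - 1 = p - 2 := by omega
  rw [e, mul_sub, Finset.mul_sum, Finset.mul_sum, ← Finset.sum_sub_distrib]
  refine Finset.sum_congr rfl fun x hx => ?_
  rw [Finset.mem_Ico] at hx
  rw [Nat.cast_choose_two, Nat.cast_choose_two]
  push_cast
  have h1 : (x : ℚ) + 3 ≠ 0 := by positivity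
  have h2 : (x : ℚ) + 4 ≠ 0 := by positivity
  have h1' : (3 : ℚ) + x ≠ 0 := by positivity
  have h2' : (4 : ℚ) + x ≠ 0 := by positivity
  rw [show ((4 : ℚ) + x - 1) = 3 + x by ring]
  field_simp
  ring

/-- `Σ_{2<u<p} C(p+2, u) = 2^{p+2} − 2 − 2(p+2) − 2·C(p+2, 2)` for `p ≥ 3`. -/
theorem sum_Ioo_choose (p : ℕ) (hp : 3 ≤ p) :
    (∑ u ∈ Ioo 2 p, ((p + 2).choose u : ℚ)) =
      2 ^ (p + 2) - 2 - 2 * (p + 2) - 2 * ((p + 2).choose 2 : ℚ) := by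
  have hfull : (∑ u ∈ range (p + 3), ((p + 2).choose u : ℚ)) = 2 ^ (p + 2) := by
    exact_mod_cast Nat.sum_range_choose (p + 2)
  have hIoo : Ioo 2 p = Ico 3 p := rfl
  have hcons := Finset.sum_Ico_consecutive (fun u => ((p + 2).choose u : ℚ)) (by omega : 0 ≤ 3)
    (by omega : 3 ≤ p)
  rw [← Finset.range_eq_Ico, ← Finset.range_eq_Ico] at hcons
  have hsplit : (∑ u ∈ range (p + 3), ((p + 2).choose u : ℚ)) =
      (∑ u ∈ range p, ((p + 2).choose u : ℚ)) + ((p + 2).choose p : ℚ) +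
        ((p + 2).choose (p + 1) : ℚ) + ((p + 2).choose (p + 2) : ℚ) := by
    rw [Finset.sum_range_succ, Finset.sum_range_succ, Finset.sum_range_succ]
  have h3 : (∑ u ∈ range 3, ((p + 2).choose u : ℚ)) = 1 + (p + 2) + ((p + 2).choose 2 : ℚ) := by
    simp [Finset.sum_range_succ]
  have hp2 : ((p + 2).choose p : ℚ) = ((p + 2).choose 2 : ℚ) := by
    have := Nat.choose_symm (n := p + 2) (k := 2) (by omega)
    rw [show p + 2 - 2 = p by omega] at this
    exact_mod_cast this
  rw [Nat.choose_succ_self_right, Nat.choose_self] at hsplit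
  push_cast at hsplit
  rw [hIoo]
  linarith [hcons, hsplit, h3, hp2, hfull]

/-- `C(p+2, p) = C(p+2, 2)`. -/
theorem choose_add_two_self (p : ℕ) : ((p + 2).choose p : ℚ) = ((p + 2).choose 2 : ℚ) := by
  have := Nat.choose_symm (n := p + 2) (k := 2) (by omega)
  rw [show p + 2 - 2 = p by omega] at this
  exact_mod_cast this

end BinomialLayer

end PercRepro
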